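import Summits.AtomisticToContinuum.Crystallization.Theorems.ExcessDecayLiouvilleEnvelopeMasses
import Summits.AtomisticToContinuum.Crystallization.Theorems.ExcessDecayLiouvilleNonlinearCaccioppoliStep
import Summits.AtomisticToContinuum.Crystallization.Theorems.ExcessDecayLiouvilleHcpLiouvilleGeometry

/-!
# Route `ExcessDecayLiouville`: value currencies of the step field (nonlinear half, XX)

Harmonic-replacement architecture for item `ExcessDecay` (stmt-AtomisticToContinuum-9334), nonlinear half.
The excess-decay induction knows the step field `v` through a CUBIC ENVELOPE `‖v x‖² ≤ C max(dist(x,c₀), ρ)³`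
on the sites of `B_{R_e}(c₀)`, a crude bound `‖v x‖ ≤ D` everywhere and a support radius `R_s` about `c₀`.
The value currencies consumed by the step:
* `mass_le_cubic` : `𝐌[v, X] ≤ 32 C X⁶` for `max(1, ρ) ≤ X ≤ R_e`;
* `mass_le_total` : `𝐌[v, X] ≤ 32 R_s³ D²` for every `X` (`R_s ≥ 1`);
* `farMass_le_cubic` : `𝐉[v, Y] ≤ 4096 C / Y² + 8192 R_s³ D² / (R_e⁷ Y)` for `max(1, ρ) ≤ Y`;
* `NN_le_mass` : `NN[v, c₀, X] ≤ 160 𝐌[v, X]` (at most `40` neighbours);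
* `sup_le_cubic` : `‖v x‖ ≤ √C · X^{3/2}`-type pointwise consequences are used inline by the callers.
All `[folklore]`; helper lemmas, nothing here closes an item.
-/

noncomputable section

namespace Summit.AtomisticToContinuum.Crystallization.Theorems.ExcessDecayLiouville

open scoped BigOperators Topology Classical
open Literature.MathematicalPhysics.StatisticalMechanics
open Summit.AtomisticToContinuum.Crystallization.Theorems.PhononStabilityNegative

set_option quotPrecheck false in
-- Local notation: ball indicator.
local notation "𝟙ᵇ[" x ", " c ", " R "]" => (if dist (x : EuclideanSpace ℝ (Fin 3)) c ≤ R then (1 : ℝ) else 0)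

section

variable {t : Fin 2 → (EuclideanSpace ℝ (Fin 3))} {A : (EuclideanSpace ℝ (Fin 3)) →L[ℝ] (EuclideanSpace ℝ (Fin 3))}
  {c₀ : EuclideanSpace ℝ (Fin 3)}

variable (hA : Adm₀ A) (hI : Inner₀ t A)

set_option quotPrecheck false in
-- local mass on the ball of radius `X` about `c₀`
local notation "𝐌[" f ", " X "]" =>
  tsum (fun p : Sites₀ t A => ‖f (p : EuclideanSpace ℝ (Fin 3))‖ ^ 2 * 𝟙ᵇ[p, c₀, X])
set_option quotPrecheck false in
-- weighted far mass with floor `Y` about `c₀`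
local notation "𝐉[" f ", " Y "]" =>
  tsum (fun q : Sites₀ t A => ‖f (q : EuclideanSpace ℝ (Fin 3))‖ ^ 2 * (max (dist (q : EuclideanSpace ℝ (Fin 3)) c₀) Y)⁻¹ ^ 8)
set_option quotPrecheck false in
-- Local notation: the finite near-neighbour form on the ball of radius `X` about `c₀`.
local notation "NN[" v ", " X "]" =>
  (∑ p ∈ (finite_sites_dist_le (t := t) (A := A) hA hI c₀ X).toFinset,
    ∑ q ∈ (finite_sites_dist_le (t := t) (A := A) hA hI c₀ X).toFinset,
      (if p ≠ q ∧ dist p q ≤ 11 / 10 then ‖v p - v q‖ ^ 2 else (0 : ℝ)))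

include hA hI in
/-- **Mass under the cubic envelope**: `𝐌[v, X] ≤ 32 C X⁶` for `1 ≤ X`, `ρ ≤ X ≤ R_e`. [folklore] -/
theorem mass_le_cubic (v : (EuclideanSpace ℝ (Fin 3)) → (EuclideanSpace ℝ (Fin 3))) {C ρ Re X : ℝ} (hC : 0 ≤ C)
    (henv : ∀ x ∈ Sites₀ t A, dist x c₀ ≤ Re → ‖v x‖ ^ 2 ≤ C * (max (dist x c₀) ρ) ^ 3)
    (hX1 : 1 ≤ X) (hρX : ρ ≤ X) (hXR : X ≤ Re) :
    𝐌[v, X] ≤ 32 * C * X ^ 6 := by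
  have hX0 : 0 ≤ X := by linarith
  have hsup : ∀ x ∈ Sites₀ t A, dist x c₀ ≤ X → ‖v x‖ ≤ Real.sqrt (C * X ^ 3) := by
    intro x hx hxd
    refine Real.le_sqrt_of_sq_le ((henv x hx (hxd.trans hXR)).trans ?_)
    have hm : max (dist x c₀) ρ ≤ X := max_le hxd hρX
    have hm0 : 0 ≤ max (dist x c₀) ρ := le_max_of_le_left dist_nonneg
    gcongr
  calc 𝐌[v, X] ≤ 32 * X ^ 3 * (Real.sqrt (C * X ^ 3)) ^ 2 := mass_le_of_pointwise hA hI v hX1 hsup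
    _ = 32 * C * X ^ 6 := by rw [Real.sq_sqrt (by positivity)]; ring

include hA hI in
/-- **Total mass**: `𝐌[v, X] ≤ 32 R_s³ D²` if `‖v‖ ≤ D` and `v` vanishes at the sites beyond `R_s ≥ 1` from `c₀`.
[folklore] -/
theorem mass_le_total (v : (EuclideanSpace ℝ (Fin 3)) → (EuclideanSpace ℝ (Fin 3))) {D Rs : ℝ} (hRs : 1 ≤ Rs)
    (hvD : ∀ x, ‖v x‖ ≤ D) (hsupp : ∀ x ∈ Sites₀ t A, Rs < dist x c₀ → v x = 0) (X : ℝ) :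
    𝐌[v, X] ≤ 32 * Rs ^ 3 * D ^ 2 := by
  calc 𝐌[v, X] ≤ 𝐌[v, Rs] := by
        refine (summable_normSq_indicator hA hI v c₀ X).tsum_le_tsum (fun p => ?_) (summable_normSq_indicator hA hI v c₀ Rs)
        by_cases hp : dist (p : EuclideanSpace ℝ (Fin 3)) c₀ ≤ Rs
        · rw [if_pos hp]
          have : 𝟙ᵇ[p, c₀, X] ≤ 1 := by split_ifs <;> norm_num
          have h0 : 0 ≤ 𝟙ᵇ[p, c₀, X] := by positivity
          nlinarith [sq_nonneg ‖v p‖]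
        · rw [hsupp p p.2 (lt_of_not_ge hp), norm_zero]; simp
    _ ≤ 32 * Rs ^ 3 * D ^ 2 := mass_le_of_pointwise hA hI v hRs fun x _ _ => hvD x

include hA hI in
/-- **Weighted far mass under the cubic envelope**:
`𝐉[v, Y] ≤ 4096 C / Y² + 8192 R_s³ D² / (R_e⁷ Y)` for `1 ≤ Y`, `ρ ≤ Y`, `0 < R_e`. [folklore] -/
theorem farMass_le_cubic (v : (EuclideanSpace ℝ (Fin 3)) → (EuclideanSpace ℝ (Fin 3))) (hv : (Function.support v).Finite)
    {C ρ Re D Rs Y : ℝ} (hC : 0 ≤ C) (hRs : 1 ≤ Rs) (hRe : 0 < Re)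
    (henv : ∀ x ∈ Sites₀ t A, dist x c₀ ≤ Re → ‖v x‖ ^ 2 ≤ C * (max (dist x c₀) ρ) ^ 3)
    (hvD : ∀ x, ‖v x‖ ≤ D) (hsupp : ∀ x ∈ Sites₀ t A, Rs < dist x c₀ → v x = 0)
    (hsupp' : ∀ x, v x ≠ 0 → x ∈ Sites₀ t A)
    (hY1 : 1 ≤ Y) (hρY : ρ ≤ Y) :
    𝐉[v, Y] ≤ 4096 * C / Y ^ 2 + 8192 * Rs ^ 3 * D ^ 2 / (Re ^ 7 * Y) := by
  have hY0 : 0 < Y := by linarith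
  -- a dyadic index covering the support
  obtain ⟨K, hK⟩ : ∃ K : ℕ, Rs ≤ 2 ^ (K + 1) * Y := by
    obtain ⟨K, hK⟩ := pow_unbounded_of_one_lt Rs (by norm_num : (1 : ℝ) < 2)
    refine ⟨K, hK.le.trans ?_⟩
    calc (2 : ℝ) ^ K = 2 ^ K * 1 := (mul_one _).symm
      _ ≤ 2 ^ (K + 1) * Y := by
          rw [pow_succ]; nlinarith [pow_pos (by norm_num : (0 : ℝ) < 2) K]
  have hKx : ∀ x, v x ≠ 0 → dist x c₀ ≤ 2 ^ (K + 1) * Y := by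
    intro x hx
    by_contra h
    exact hx (hsupp x (hsupp' x hx) (lt_of_le_of_lt hK (lt_of_not_ge h)))
  have h := farMass_le_of_masses (t := t) (A := A) (c₀ := c₀) v hv hY0 hRe (by positivity : (0 : ℝ) ≤ 32 * C)
    (by positivity : (0 : ℝ) ≤ 32 * Rs ^ 3 * D ^ 2) K hKx
    (fun n hn => by
      have h1 : (1 : ℝ) ≤ 2 ^ (n + 1) * Y := by
        have : (1 : ℝ) ≤ 2 ^ (n + 1) := one_le_pow₀ (by norm_num)
        nlinarith
      have h2 : ρ ≤ 2 ^ (n + 1) * Y := by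
        have : (1 : ℝ) ≤ 2 ^ (n + 1) := one_le_pow₀ (by norm_num)
        nlinarith
      calc _ ≤ 32 * C * (2 ^ (n + 1) * Y) ^ 6 := mass_le_cubic hA hI v hC henv h1 h2 hn
        _ = _ := by ring)
    (fun n => mass_le_total hA hI v hRs hvD hsupp _)
  refine h.trans (le_of_eq ?_)
  ring

include hA hI in
/-- **At most `40` neighbours**: `NN[v, c₀, X] ≤ 160 𝐌[v, X]`. [folklore] -/
theorem NN_le_mass (v : (EuclideanSpace ℝ (Fin 3)) → (EuclideanSpace ℝ (Fin 3))) (X : ℝ) :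
    NN[v, X] ≤ 160 * 𝐌[v, X] := by
  classical
  rw [tsum_indicator_eq_sum hA hI (fun x => ‖v x‖ ^ 2) c₀ X]
  set F := (finite_sites_dist_le (t := t) (A := A) hA hI c₀ X).toFinset with hF
  have hmemF : ∀ x ∈ F, x ∈ Sites₀ t A ∧ dist x c₀ ≤ X := fun x hx => by
    have h := (Set.Finite.mem_toFinset (finite_sites_dist_le (t := t) (A := A) hA hI c₀ X)).1 hx
    exact h
  -- neighbour count
  have hcount : ∀ p ∈ F, ((F.filter (fun q => p ≠ q ∧ dist p q ≤ 11 / 10)).card : ℝ) ≤ 40 := by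
    intro p _
    have h := LevelOne.card_sites_le' hA hI p (by norm_num : (0 : ℝ) ≤ 11 / 10) (F.filter (fun q => p ≠ q ∧ dist p q ≤ 11 / 10))
      (fun s hs => by
        rw [Finset.mem_filter] at hs
        exact ⟨(hmemF s hs.1).1, by rw [dist_comm]; exact hs.2.2⟩)
    refine h.trans ?_
    norm_num
  -- pointwise split
  have hsplit : ∀ p ∈ F, ∀ q ∈ F, (if p ≠ q ∧ dist p q ≤ 11 / 10 then ‖v p - v q‖ ^ 2 else (0 : ℝ)) ≤
      (if p ≠ q ∧ dist p q ≤ 11 / 10 then (1 : ℝ) else 0) * (2 * ‖v p‖ ^ 2) +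
      (if q ≠ p ∧ dist q p ≤ 11 / 10 then (1 : ℝ) else 0) * (2 * ‖v q‖ ^ 2) := by
    intro p _ q _
    by_cases h : p ≠ q ∧ dist p q ≤ 11 / 10
    · have h' : q ≠ p ∧ dist q p ≤ 11 / 10 := ⟨Ne.symm h.1, by rw [dist_comm]; exact h.2⟩
      rw [if_pos h, if_pos h, if_pos h', one_mul, one_mul]
      have := norm_sub_le (v p) (v q)
      nlinarith [sq_nonneg (‖v p‖ - ‖v q‖), norm_nonneg (v p - v q), norm_nonneg (v p), norm_nonneg (v q)]
    · rw [if_neg h]; positivity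
  calc NN[v, X] ≤ ∑ p ∈ F, ∑ q ∈ F, ((if p ≠ q ∧ dist p q ≤ 11 / 10 then (1 : ℝ) else 0) * (2 * ‖v p‖ ^ 2) +
        (if q ≠ p ∧ dist q p ≤ 11 / 10 then (1 : ℝ) else 0) * (2 * ‖v q‖ ^ 2)) :=
        Finset.sum_le_sum fun p hp => Finset.sum_le_sum fun q hq => hsplit p hp q hq
    _ = ∑ p ∈ F, (∑ q ∈ F, (if p ≠ q ∧ dist p q ≤ 11 / 10 then (1 : ℝ) else 0)) * (2 * ‖v p‖ ^ 2) +
        ∑ q ∈ F, (∑ p ∈ F, (if q ≠ p ∧ dist q p ≤ 11 / 10 then (1 : ℝ) else 0)) * (2 * ‖v q‖ ^ 2) := by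
        rw [show (∑ p ∈ F, ∑ q ∈ F, ((if p ≠ q ∧ dist p q ≤ 11 / 10 then (1 : ℝ) else 0) * (2 * ‖v p‖ ^ 2) +
            (if q ≠ p ∧ dist q p ≤ 11 / 10 then (1 : ℝ) else 0) * (2 * ‖v q‖ ^ 2))) =
            ∑ p ∈ F, ((∑ q ∈ F, (if p ≠ q ∧ dist p q ≤ 11 / 10 then (1 : ℝ) else 0) * (2 * ‖v p‖ ^ 2)) +
              ∑ q ∈ F, (if q ≠ p ∧ dist q p ≤ 11 / 10 then (1 : ℝ) else 0) * (2 * ‖v q‖ ^ 2)) from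
            Finset.sum_congr rfl fun p _ => Finset.sum_add_distrib, Finset.sum_add_distrib]
        congr 1
        · exact Finset.sum_congr rfl fun p _ => by rw [Finset.sum_mul]
        · rw [Finset.sum_comm]
          exact Finset.sum_congr rfl fun q _ => by rw [Finset.sum_mul]
    _ ≤ ∑ p ∈ F, 40 * (2 * ‖v p‖ ^ 2) + ∑ q ∈ F, 40 * (2 * ‖v q‖ ^ 2) := by
        have hc : ∀ p ∈ F, (∑ q ∈ F, (if p ≠ q ∧ dist p q ≤ 11 / 10 then (1 : ℝ) else 0)) ≤ 40 := by
          intro p hp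
          rw [← Finset.sum_filter, Finset.sum_const, nsmul_eq_mul, mul_one]
          exact hcount p hp
        exact add_le_add (Finset.sum_le_sum fun p hp => mul_le_mul_of_nonneg_right (hc p hp) (by positivity))
          (Finset.sum_le_sum fun q hq => mul_le_mul_of_nonneg_right (hc q hq) (by positivity))
    _ = 160 * ∑ x ∈ F, ‖v x‖ ^ 2 := by
        rw [← Finset.sum_add_distrib, Finset.mul_sum]
        exact Finset.sum_congr rfl fun x _ => by ring

end

end Summit.AtomisticToContinuum.Crystallization.Theorems.ExcessDecayLiouville

end
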